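import Literature.MathematicalPhysics.QuantumFieldTheory.Balaban1983to89.B9Thm34GKernelFinal
import Literature.MathematicalPhysics.QuantumFieldTheory.Balaban1983to89.B9Thm34GUniform

/-!
# `Balaban1983to89.B9Thm34POneUniformR1` — [Balaban1985BackgroundPropagators] (3.77) p. 406 FOR THE CONCRETE `P₁(A)`, THRESHOLD AND CONSTANT
# BEFORE THE LATTICE (r06 FILE 47 `B9Thm34GKernelUniform.exists_threshold_pOne_uniform`) — RESTATED WITH THE [4] LEMMA 2.1 INPUTS ASKED ONLY FOR
# THE EXPONENTS THE PROOF USES: `9/5000 ≤ α` instead of `0 < α` («R1» of the pub-ymgap N06 row-13 lineage, seat dag-n06-c gen 6; statement-only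
# change, proof verbatim; kernel-free)

statement-level skeleton of published theorems with citation tags; proofs where landed; nothing here is a claim about the Yang–Mills mass gap

CITATION HEADER (lean-in-tree rule).  B9 = T. Bałaban, *Propagators for lattice gauge theories in a background field*, Commun. Math. Phys.
**99** (1985) 389–434 [Balaban1985BackgroundPropagators] (held `paper:balaban1985-cmp99-background-propagators`; journal page = PDF page + 388):
p. 406 [PDF 18] «Using Lemma 2.1 [4], we can estimate easily the above expression and we get |(P₁(A)f)(b)| ≦ O(1)α₁(Lʲη)⁻²e^{−(1/2)δ₀d(y,y′)}|f|
(3.77)»; (3.76) p. 405; (3.65)–(3.68) p. 403 [PDF 15]; Theorem 3.2 (3.48) p. 398; Theorem 3.1 (3.42) p. 397; p. 399 [PDF 11] L1–3 «the constants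
in the formulations of both theorems do not depend on the sequence {Ω_j}».  [4] = [Balaban1984PropagatorsII] (2.51)–(2.55) p. 232; Lemma 2.1
p. 234 [PDF 12]: «For the numbers α, 0 < α < 1, c₁(α) = 12c₀(½α), and RM satisfying (2.59) … (2.61)»; (2.59) p. 233: «Now we require that RM is
sufficiently large, i.e. we assume ¼αδ₀RM > 2d log c₀(½α) + 1».  Rows B9.Eq3.77 × B9.Thm3.2 × B6.Lemma2.1 (cells only; no row head changes).

WHY THIS FILE (pub-ymgap N06 row 13, dag-n06-c LOCATED-4 ∕ `GSIDE-L2-SPEC.md` §G; sibling of `B9Thm34SectBUniformR1`, `B9Thm34GUniformR1`,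
`B9Thm34HolderGpUniformR1`, whose headers state the case in full).  r06's FILE 47 hypothesises [4] Lemma 2.1 and the p. 398 scale transfer «for EVERY
0 < α < 1» (`∀ α, 0 < α → α < 1 → Ineq261 …`, `∀ α, 0 < α → ScaleTransfer …`) with no trace of the printed size condition (2.59), whose
M-threshold grows without bound as α → 0 — FALSE over every multiscale family with unboundedly many scales at fixed M, although the proof USES the
two binders at literal exponents only (1/100, 33/10000, 49/5000, 1/10, 3/5, 1/25 — all ≥ 9/5000).  The kernel-free G-side Hölder chain of the
row-13 frames (`B9SectBGHolderLeftAtLetters` and its successors: the (3.43)-right member and (3.44)/(3.45) of G(U′U) on r06's kernel-free clause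
`B9Thm34GUniformR1.thm34_G_clause_uniform`) needs (3.77) in the R1 binder shape the frames' Lemma-2.1 fields supply; THIS FILE is that twin: the two
binder texts `0 < α → α < 1 → Ineq261 …` ⟶ `9 / 5000 ≤ α → α < 1 → Ineq261 …`, `0 < α → ScaleTransfer …` ⟶ `9 / 5000 ≤ α → ScaleTransfer …`,
and NOTHING ELSE changed (proof byte for byte; the literal-exponent discharges `by norm_num` close as before).  Count-neutral, supersedable by an
in-place edit of the r06 chain.

WHAT IS PROVED (1 theorem: 0 `def`, 0 sorry, 0 new named facts; standard axioms) — under FILE 47's short name in the namespace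
`…B9Thm34POneUniformR1`:
* **`exists_threshold_pOne_uniform`** — `∃ a₁ > 0 ∃ K ≧ 0 ∀ (lattice, background, (3.19)/(3.60) data, Theorem 3.1 (3.42)₁₋₃ for G′(U), (3.19)
  letters + section, Theorem 3.2 for U) ∀ α₁ ≦ a₁ ∀ A ∈ (3.37) ∀ (3.57)/(3.59) letters ∃ C⁻¹(U′U)` (two-sided inverse of
  `Q′(U′U)G′²(U′U)Q′*(U′U)`) with the (3.77) block majorant `P₁(A) ≺ Kα₁(Lʲη)⁻²e^{−(δ₀/4)d}` of the concrete `P₁(A)` — FILE 47 verbatim but for the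
  two binders.

PROOF.  FILE 47 §2 verbatim (FILE 25 `B9Thm34GKernelFinal.exists_cinv_pOne_concrete` per lattice at literal exponents; the four threshold
functions and the bound `K` by `exists_threshold_of_continuousAt` ∕ `exists_bound_of_continuousAt` before the lattice) — all BY NAME.

HONEST SCOPE / NOT CLAIMED.  As FILE 47: Theorem 3.1 for `G′(U)` and Theorem 3.2 for `U` are inputs; letters as block-majorant hypotheses of
the printed shape; rates one admissible choice.  The ONLY difference is the weaker Lemma-2.1 hypothesis; 9/5000 is a proof constant of the r06
chain, not a printed number.  Nothing of [B9] is asserted; no row head changes; NOT a node discharge; nothing continuum / OS / mass-gap / Clay.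
Cell `pub-ymgap` (HUMAN RULING D-0062), Track A node N06 [B9], N06-ASSIGNMENT row 13, seat `pub-ymgap-dag-n06-c` (g6), 2026-08-27.

RELATED IN THE TREE, NOT DUPLICATED: FILE 47 `B9Thm34GKernelUniform.exists_threshold_pOne_uniform` (the «∀ 0 < α < 1» statement; kept — it has
importers), FILE 25 `B9Thm34GKernelFinal` (per lattice) and everything they use BY NAME; no existing module modified.
-/

noncomputable section

namespace Literature.MathematicalPhysics.QuantumFieldTheory.Balaban1983to89.B9Thm34POneUniformR1

open NormedSpace Complex
open Literature.MathematicalPhysics.QuantumFieldTheory.Balaban1983to89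

/-! ## FILE 47 §2 with the R1 binders -/

section POneU

open Literature.MathematicalPhysics.QuantumFieldTheory.Balaban1983to89.B6RandomWalk (HasMajorant hasMajorant_mono Triangle254 Ineq261)
open Literature.MathematicalPhysics.QuantumFieldTheory.Balaban1983to89.B6RandomWalkHom (HasMajorantHom hasMajorantHom_mono hasMajorantHom_iff)
open Literature.MathematicalPhysics.QuantumFieldTheory.Balaban1983to89.B6RandomWalkKernel (HasKernelBound hasKernelBound_mono)
open Literature.MathematicalPhysics.QuantumFieldTheory.Balaban1983to89.B9Thm34Ext (toB6)
open Literature.MathematicalPhysics.QuantumFieldTheory.Balaban1983to89.B9Ineq347 (ScaleTransfer)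
open Literature.MathematicalPhysics.QuantumFieldTheory.Balaban1983to89.B9Ineq366CPrime (hasMajorant_rate_mono cPrimeHom kappa366 kappa366_nonneg
  kappa366_pos)
open Literature.MathematicalPhysics.QuantumFieldTheory.Balaban1983to89.B9Eq386Neumann (pTwo deltaA)
open Literature.MathematicalPhysics.QuantumFieldTheory.Balaban1983to89.B9Ineq377POne (kappa377 kappa377_nonneg)
open Literature.MathematicalPhysics.QuantumFieldTheory.Balaban1983to89.B9Ineq385VG (kappa383 kappa383_nonneg kappa385 kappa385_nonneg)
open Literature.MathematicalPhysics.QuantumFieldTheory.Balaban1983to89.B9Eq39Adjoint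
open Literature.MathematicalPhysics.QuantumFieldTheory.Balaban1983to89.B9Eq369Small (Through)
open Literature.MathematicalPhysics.QuantumFieldTheory.Balaban1983to89.B9Eq372Locality (stBonds)
open Literature.MathematicalPhysics.QuantumFieldTheory.Balaban1983to89.B9Eq352DivForm (tauF tauB)
open Literature.MathematicalPhysics.QuantumFieldTheory.Balaban1983to89.B9Eq352DivFormLetters
open Literature.MathematicalPhysics.QuantumFieldTheory.Balaban1983to89.B9Eq352GradLetters (diffLetter)
open Literature.MathematicalPhysics.QuantumFieldTheory.Balaban1983to89.B9Eq371GradLetters (bT bU)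
open Literature.MathematicalPhysics.QuantumFieldTheory.Balaban1983to89.B9Eq372RemLetters (lapDDLetter)
open Literature.MathematicalPhysics.QuantumFieldTheory.Balaban1983to89.B9Eq382V3Letters (dPrimeLetter)
open Literature.MathematicalPhysics.QuantumFieldTheory.Balaban1983to89.B9Eq376POneLetters (conjHom gradLin divLin)
open Literature.MathematicalPhysics.QuantumFieldTheory.Balaban1983to89.B9Ineq385V3Concrete (cV385 cV385_nonneg)
open Literature.MathematicalPhysics.QuantumFieldTheory.Balaban1983to89.B9Ineq377POneConcrete (ineq377_concreteE)
open Literature.MathematicalPhysics.QuantumFieldTheory.Balaban1983to89.B9Ineq349Hom (ineq349_hom)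
open Literature.MathematicalPhysics.QuantumFieldTheory.Balaban1983to89.B9Ineq368PPrime (kappa349 kappa368)
open Literature.MathematicalPhysics.QuantumFieldTheory.Balaban1983to89.B9Ineq368PPrimeDs (kappa368Ds kappa368Ds_nonneg kappa368_nonneg kappa349_nonneg)
open Literature.MathematicalPhysics.QuantumFieldTheory.Balaban1983to89.B9Eq360Vprime (gPrimeExtEnd eq365_end_left eq365_end opNorm_lt_one_of_363_261)
open Literature.MathematicalPhysics.QuantumFieldTheory.Balaban1983to89.B9Eq360VprimeLetters (vPrimeConc cBConc cCConc)
open Literature.MathematicalPhysics.QuantumFieldTheory.Balaban1983to89.B9Ineq363Vprime (cVConc cVConc_nonneg theta363 thetaL363 theta363_nonneg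
  thetaL363_nonneg ineq363_op_vPrime)
open Literature.MathematicalPhysics.QuantumFieldTheory.Balaban1983to89.B9Ineq368Vprime (ineq368_op_conc ineq368_op_D_conc ineq368_op_Ds_conc
  ineq368_op_DDs_conc)
open Literature.MathematicalPhysics.QuantumFieldTheory.Balaban1983to89.B9Eq376DerivDict (hasMajorantHom_gradLin_comp hasMajorantHom_gradLin
  hasMajorantHom_comp_divLin hasMajorantHom_divLin hasMajorant_gradLin_comp_comp_divLin)
open Literature.MathematicalPhysics.QuantumFieldTheory.Balaban1983to89.B6RandomWalkSection
open Literature.MathematicalPhysics.QuantumFieldTheory.Balaban1983to89.B9Ineq366Vprime (eq365b_hom hasMajorant_cPrimeHom_vPrime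
  inverse_satisfies_thm32_vPrime)
open Literature.MathematicalPhysics.QuantumFieldTheory.Balaban1983to89.B9Thm34GFinal (ineq261_rescale scaleTransfer_rescale c1_pos_of_ineq261
  exists_threshold_of_continuousAt)
open Literature.MathematicalPhysics.QuantumFieldTheory.Balaban1983to89.B9Thm34GKernel (thm34_G_kernelEntriesAll)
/-! ## §1  (3.77) for the concrete `P₁(A)` as a theorem (site letters; coarse letters through a section) -/
open Literature.MathematicalPhysics.QuantumFieldTheory.Balaban1983to89.B9Thm34GKernelFinal (exists_cinv_pOne_concrete exists_bound_of_continuousAt)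
open Literature.MathematicalPhysics.QuantumFieldTheory.Balaban1983to89.B6RandomWalk (c1_nonneg)

variable {𝔸 : Type*} [NormedRing 𝔸] [NormedAlgebra ℂ 𝔸] [CompleteSpace 𝔸] {ι : Type} [Fintype ι]
variable (b : Module.Basis ι ℝ 𝔸) (κ : Type) [Fintype κ]

set_option maxHeartbeats 800000 in
/-- **(3.77) FOR THE CONCRETE `P₁(A)` WITH THE PRINTED QUANTIFIERS, THRESHOLD AND CONSTANT BEFORE THE LATTICE** — FILE 25
`B9Thm34GKernelFinal.exists_threshold_pOne` verbatim in hypotheses and conclusion (p. 406 «Using Lemma 2.1 [4], we can estimate easily the above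
expression and we get |(P₁(A)f)(b)| ≦ O(1)α₁(Lʲη)⁻²e^{−(1/2)δ₀d(y,y′)}|f| (3.77)»; p. 403 (3.65)–(3.67)), re-quantified `∃ a₁ > 0 ∃ K ≧ 0 ∀ (lattice,
background, (3.19)/(3.60) data, Theorem 3.1 (3.42)₁₋₃ for G′(U), (3.19) letters + section, Theorem 3.2 for U) ∀ α₁ ≦ a₁ ∀ A … ∀ (3.57)/(3.59) letters`:
the four threshold functions of the `C⁻¹(U′U)`/`P′(A)`-chain and the bound `K` of the explicit (3.77) constant are lattice-free. (R1: [4] Lemma 2.1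
(2.61) and the p. 398 scale transfer are hypothesised for the exponents `9/5000 ≦ α` only — the ones the proof uses — instead of r06's «every
0 < α < 1»; nothing else differs from the r06 original `B9Thm34GKernelUniform.exists_threshold_pOne_uniform`.)
[cite: Balaban1985BackgroundPropagators, (3.76)–(3.77) pp.405–406 + (3.65)–(3.68) p.403 + Thm 3.2 (3.48) p.398 + Thm 3.1 (3.42) p.397 + (3.19)/(3.25) pp.393–394 + (3.57) p.401 + (3.59) p.402 + p.399; Balaban1984PropagatorsII, Lemma 2.1 p.234 + (2.51)–(2.55) p.232] -/
theorem exists_threshold_pOne_uniform [DecidableEq ι] (d : ℕ)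
    (δ₀ κQ BG B₁ cF Cq a₀ d₀ M₂ : ℝ) (Λf : ℝ → ℝ)
    (hκQ : 0 < κQ) (hBG : 0 < BG) (hB₁ : 0 < B₁) (hcF : 0 < cF) (hCq : 0 ≤ Cq) (ha₀ : 0 ≤ a₀) (hM₂ : 0 ≤ M₂) (hδ₀ : 0 < δ₀) (hΛf : ∀ α : ℝ, 0 < α → 1 ≤ Λf α)
    (hrepr : ∀ (v : 𝔸) (i : ι), |b.repr v i| ≤ M₂ * ‖v‖) :
    ∃ a₁ : ℝ, 0 < a₁ ∧ ∃ K : ℝ, 0 ≤ K ∧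
    ∀ {S : Type} [Fintype S] [DecidableEq S] (T : κ → Equiv.Perm S) (U : κ → S → 𝔸ˣ)
      {g : B9.Geometry} [Fintype g.Site] [DecidableEq g.Site] [Nonempty g.Site] {Rr : ℝ} {H : Prop} (blk : S → g.Site)
      (kQ : g.Site → S → 𝔸 →L[ℝ] 𝔸) (sQ : S → 𝔸 →L[ℝ] 𝔸) (cfun w : g.Site → ℝ)
    -- the multiscale geometry 𝔅 and its axioms
    (hdnn : ∀ a a' : g.Site, 0 ≤ g.dist a a') (htri : Triangle254 (toB6 g Rr H)) (hrefl : ∀ y : g.Site, g.dist y y = 0)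
    (hsym : ∀ y y' : g.Site, g.dist y y' = g.dist y' y) (hlen : ∀ y : g.Site, 0 < g.len y) (hlenη : ∀ y : g.Site, g.eta ≤ g.len y)
    (hη : 0 < g.eta)
    -- [4] Lemma 2.1 (2.61) at the rate `δ₀`, for every exponent `9/5000 ≤ α < 1` (R1: the exponents the proof uses; print: «0 < α < 1» with (2.59)), and the p. 398 scale transfer for the same exponents
    (h261 : ∀ α : ℝ, 9 / 5000 ≤ α → α < 1 → Ineq261 d (toB6 g Rr H) δ₀ α)
      (hST : ∀ α : ℝ, 9 / 5000 ≤ α → ScaleTransfer g δ₀ α (Λf α) (fun a => g.len a) ∧ ScaleTransfer g δ₀ α (Λf α) (fun a => g.len a ^ 2) ∧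
        ScaleTransfer g δ₀ α (Λf α) (fun a => (g.len a)⁻¹) ∧ ScaleTransfer g δ₀ α (Λf α) (fun a => (g.len a ^ 2)⁻¹) ∧
        ScaleTransfer g δ₀ α (Λf α) (fun a => (g.len a ^ 4)⁻¹) ∧ ScaleTransfer g δ₀ α (Λf α) (fun y => g.len y ^ (-(4 : ℝ))))
    (hU1 : ∀ m z, ‖((U m z : 𝔸ˣ) : 𝔸)‖ ≤ 1 ∧ ‖(((U m z)⁻¹ : 𝔸ˣ) : 𝔸)‖ ≤ 1)
    (hd₀B : ∀ μ x, g.dist (blk x) (blk ((T μ).symm x)) ≤ d₀) (hd₀F : ∀ μ x, g.dist (blk x) (blk (T μ x)) ≤ d₀)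
    (hd₀0 : ∀ y : g.Site, g.dist y y ≤ d₀)
    -- the `A`-independent data of the concrete `V′(A)` of (3.60)
    (hw : ∀ y, 0 ≤ w y) (hcard : ∀ y, ((B9Eq360Vprime.block blk y).card : ℝ) * w y ≤ 1)
    (hkQ : ∀ y x, blk x = y → ‖kQ y x‖ ≤ w y) (hsQ : ∀ x, ‖sQ x‖ ≤ 1) (hcfun : ∀ y, |cfun y| ≤ a₀ * (g.len y ^ 2)⁻¹)
    -- THEOREM 3.1 for `G′(U)`: (3.42)₁,₂,₃ at the rate `δ₀`
    {Gp : Module.End ℝ (S × ι → ℝ)}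
    (h342_1 : HasMajorant (g := toB6 g Rr H) (fun p : S × ι => blk p.1) Gp
      (fun a a' => BG * g.len a ^ 2 * Real.exp (-(δ₀ * g.dist a a'))))
    (h342_2 : ∀ k : κ ⊕ κ, HasMajorant (g := toB6 g Rr H) (fun p : S × ι => blk p.1)
      (conj b (diffLetter T U ((g.eta : ℂ)⁻¹) k) * Gp) (fun a a' => BG * g.len a * Real.exp (-(δ₀ * g.dist a a'))))
    (h342_3 : ∀ k : κ ⊕ κ, HasMajorant (g := toB6 g Rr H) (fun p : S × ι => blk p.1)
      (Gp * conj b (diffLetter T U ((g.eta : ℂ)⁻¹) k)) (fun a a' => BG * g.len a * Real.exp (-(δ₀ * g.dist a a'))))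
    -- the (3.19) letters `Q′(U)`, `Q′*(U)` in their own typing with block-local two-space majorants, a section of the block map (FILE 17)
    (rep : g.Site → S × ι) (hrep : ∀ y : g.Site, blk (rep y).1 = y)
    {Qc : (S × ι → ℝ) →ₗ[ℝ] (g.Site → ℝ)} {Qcs : (g.Site → ℝ) →ₗ[ℝ] (S × ι → ℝ)} {Linv : Module.End ℝ (g.Site → ℝ)}
    (hQc : HasMajorantHom (g := toB6 g Rr H) (fun p : S × ι => blk p.1) (fun y : g.Site => y) Qc
      (fun a a' : g.Site => κQ * (if a = a' then (1 : ℝ) else 0)))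
    (hQcs : HasMajorantHom (g := toB6 g Rr H) (fun y : g.Site => y) (fun p : S × ι => blk p.1) Qcs
      (fun a a' : g.Site => κQ * (if a = a' then (1 : ℝ) else 0)))
    -- THEOREM 3.2 for `U`: (3.21) `C⁻¹ = (Q′G′²Q′*)⁻¹` exists (`hLinv`) with the KERNEL bound (3.48) at the rate `δ₀`
    (hLinv : (Qc ∘ₗ (Gp * Gp) ∘ₗ Qcs) * Linv = 1)
    (h348 : ∀ y y' : g.Site, |B9Thm34Inv.ker (B9Thm34Inv.vol g d) Linv y y'| ≤
      B₁ * g.len y ^ (-(4 : ℝ)) * g.len y' ^ (-(d : ℝ)) * Real.exp (-(δ₀ * g.dist y y'))),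
    ∀ (α₁ : ℝ), 0 ≤ α₁ → α₁ ≤ a₁ →
    -- the exponent field `A` in the domain (3.37), read blockwise, and the `A`-dependent (3.59) data `kF`, `sF`
    ∀ (A : κ → S → 𝔸) (kF : g.Site → S → 𝔸 →L[ℝ] 𝔸) (sF : S → 𝔸 →L[ℝ] 𝔸),
      (∀ y x, blk x = y → ‖kF y x‖ ≤ Cq * α₁ * w y) → (∀ x, ‖sF x‖ ≤ Cq * α₁) →
      (∀ ν k x, ‖((g.eta : ℂ)⁻¹) • covDstar T U ν (A k) x‖ ≤ α₁ * (g.len (blk x) ^ 2)⁻¹) →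
      (∀ μ ν x, ‖((g.eta : ℂ)⁻¹) • covD T U μ (A ν) x‖ ≤ α₁ * (g.len (blk x) ^ 2)⁻¹) →
      (∀ μ x, ‖((g.eta : ℂ)⁻¹) • covDstar T U μ (tauB T U μ (A μ)) x‖ ≤ α₁ * (g.len (blk x) ^ 2)⁻¹) →
      (∀ k x, ‖A k x‖ ≤ α₁ * (g.len (blk x))⁻¹) → (∀ ν k x, ‖tauB T U ν (A k) x‖ ≤ α₁ * (g.len (blk x))⁻¹) →
    -- the (3.57)/(3.59) letters `F′₂(A)`, `F′₂*(A)` (block-local, size `c_F α₁`)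
    ∀ {Qc' Fc : (S × ι → ℝ) →ₗ[ℝ] (g.Site → ℝ)} {Qcs' Fcs : (g.Site → ℝ) →ₗ[ℝ] (S × ι → ℝ)},
      Qc' = Qc + Fc → Qcs' = Qcs + Fcs →
      HasMajorantHom (g := toB6 g Rr H) (fun p : S × ι => blk p.1) (fun y : g.Site => y) Fc
        (fun a a' : g.Site => cF * α₁ * (if a = a' then (1 : ℝ) else 0)) →
      HasMajorantHom (g := toB6 g Rr H) (fun y : g.Site => y) (fun p : S × ι => blk p.1) Fcs
        (fun a a' : g.Site => cF * α₁ * (if a = a' then (1 : ℝ) else 0)) →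
    ∃ Tinv : Module.End ℝ (g.Site → ℝ),
      Tinv * (Qc' ∘ₗ ((gPrimeExtEnd Gp (conj b (vPrimeConc T U g.eta A blk kQ kF sQ sF cfun) * Gp)) * (gPrimeExtEnd Gp (conj b (vPrimeConc T U g.eta A blk kQ kF sQ sF cfun) * Gp))) ∘ₗ Qcs') = 1 ∧
      (Qc' ∘ₗ ((gPrimeExtEnd Gp (conj b (vPrimeConc T U g.eta A blk kQ kF sQ sF cfun) * Gp)) * (gPrimeExtEnd Gp (conj b (vPrimeConc T U g.eta A blk kQ kF sQ sF cfun) * Gp))) ∘ₗ Qcs') * Tinv = 1 ∧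
      HasMajorant (g := toB6 g Rr H) (fun q : (κ × S) × ι => blk q.1.2)
        (((conjHom b (gradLin T ((g.eta : ℂ)⁻¹) (prodCfg U g.eta A)) - conjHom b (gradLin T ((g.eta : ℂ)⁻¹) U)) ∘ₗ (Gp ∘ₗ Qcs ∘ₗ Linv ∘ₗ Qc ∘ₗ Gp) ∘ₗ conjHom b (divLin T ((g.eta : ℂ)⁻¹) U)
              + conjHom b (gradLin T ((g.eta : ℂ)⁻¹) U) ∘ₗ (Gp ∘ₗ Qcs ∘ₗ Linv ∘ₗ Qc ∘ₗ Gp) ∘ₗ (conjHom b (divLin T ((g.eta : ℂ)⁻¹) (prodCfg U g.eta A)) - conjHom b (divLin T ((g.eta : ℂ)⁻¹) U))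
              + (conjHom b (gradLin T ((g.eta : ℂ)⁻¹) (prodCfg U g.eta A)) - conjHom b (gradLin T ((g.eta : ℂ)⁻¹) U)) ∘ₗ (Gp ∘ₗ Qcs ∘ₗ Linv ∘ₗ Qc ∘ₗ Gp) ∘ₗ (conjHom b (divLin T ((g.eta : ℂ)⁻¹) (prodCfg U g.eta A)) - conjHom b (divLin T ((g.eta : ℂ)⁻¹) U))
              + conjHom b (gradLin T ((g.eta : ℂ)⁻¹) (prodCfg U g.eta A)) ∘ₗ (B9Eq360Vprime.pPrime Gp (gPrimeExtEnd Gp (conj b (vPrimeConc T U g.eta A blk kQ kF sQ sF cfun) * Gp)) (Qcs ∘ₗ secRes rep) (Qcs' ∘ₗ secRes rep) (secConj rep Linv) (secConj rep Tinv) (secExt rep ∘ₗ Qc) (secExt rep ∘ₗ Qc')) ∘ₗ conjHom b (divLin T ((g.eta : ℂ)⁻¹) (prodCfg U g.eta A))))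
        (fun a a' => K * α₁ * (g.len a ^ 2)⁻¹ * Real.exp (-(1 / 5 * δ₀ * g.dist a a'))) := by
  classical
  have hSb : 0 ≤ ∑ i, ‖b i‖ := Finset.sum_nonneg fun i _ => norm_nonneg _
  -- the three scale-transfer constants of the chain, READ FROM THE GIVEN FUNCTION `Λ(·)` (lattice-free), under the names of FILE 25
  obtain ⟨Λ, hΛ, hΛeq⟩ : ∃ Λ : ℝ, 1 ≤ Λ ∧ Λf (1 / 100) = Λ := ⟨_, hΛf _ (by norm_num), rfl⟩
  obtain ⟨Λρ₁, hΛρ₁1, hΛρ₁eq⟩ : ∃ Λρ₁ : ℝ, 1 ≤ Λρ₁ ∧ Λf (1 / 100 * (33 / 100)) = Λρ₁ := ⟨_, hΛf _ (by norm_num), rfl⟩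
  obtain ⟨c₄, hc₄1, hc₄eq⟩ : ∃ c₄ : ℝ, 1 ≤ c₄ ∧ Λf (1 / 10) = c₄ := ⟨_, hΛf _ (by norm_num), rfl⟩
  have hΛ0 : 0 < Λ := zero_lt_one.trans_le hΛ
  have hΛρ₁ : 0 ≤ Λρ₁ := zero_le_one.trans hΛρ₁1
  have hc₄ : 0 < c₄ := zero_lt_one.trans_le hc₄1
  -- «for α₁ sufficiently small» (pp. 402, 403): the threshold functions and the bound `K` are lattice-free — evaluated BEFORE the lattice
  obtain ⟨ε₁, hε₁, hF1⟩ := exists_threshold_of_continuousAt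
    (f := fun α₁ : ℝ => theta363 (Fintype.card κ) 1 α₁ a₀ Cq M₂ (∑ i, ‖b i‖) (Real.exp (δ₀ * d₀)) BG Λ (B6.c1 d δ₀ (1 / 100)) * B6.c1 d (49 / 50 * δ₀) (1 / 100))
    (by unfold theta363 kappa385 cVConc cBConc; fun_prop) (by simp [theta363])
  obtain ⟨ε₂, hε₂, hF2⟩ := exists_threshold_of_continuousAt
    (f := fun α₁ : ℝ => theta363 (Fintype.card κ) 1 α₁ a₀ Cq M₂ (∑ i, ‖b i‖) (Real.exp (7 / 20 * δ₀ * d₀)) BG Λ (B6.c1 d δ₀ (1 / 100)) * B6.c1 d (33 / 100 * δ₀) (1 / 100))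
    (by unfold theta363 kappa385 cVConc cBConc; fun_prop) (by simp [theta363])
  obtain ⟨ε₃, hε₃, hF3⟩ := exists_threshold_of_continuousAt
    (f := fun α₁ : ℝ => thetaL363 (Fintype.card κ) 1 α₁ a₀ Cq M₂ (∑ i, ‖b i‖) (Real.exp (7 / 20 * δ₀ * d₀)) BG Λ (B6.c1 d δ₀ (1 / 100)) * B6.c1 d (33 / 100 * δ₀) (1 / 100))
    (by unfold thetaL363 kappa385 cVConc cBConc; fun_prop) (by simp [thetaL363])
  obtain ⟨ε₅, hε₅, hF5⟩ := exists_threshold_of_continuousAt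
    (f := fun α₁ : ℝ => α₁ * (2 * (kappa366 κQ cF (kappa385 1 (cVConc (Fintype.card κ) 1 α₁ a₀ Cq M₂ (∑ i, ‖b i‖) (Real.exp (δ₀ * d₀))) 0 0 Λ (B6.c1 d δ₀ (1 / 100))) BG (BG * B6.c1 d (49 / 50 * δ₀) (1 / 100) * (1 - theta363 (Fintype.card κ) 1 α₁ a₀ Cq M₂ (∑ i, ‖b i‖) (Real.exp (δ₀ * d₀)) BG Λ (B6.c1 d δ₀ (1 / 100)) * B6.c1 d (49 / 50 * δ₀) (1 / 100))⁻¹) Λ (B6.c1 d δ₀ (1 / 100)) α₁ * B₁ * c₄ * B6.c1 d δ₀ (1 / 2 + 1 / 10)) * B6.c1 d ((1 / 2 - 1 / 10) * δ₀) (1 / 10)))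
    (by
      unfold theta363 kappa366 kappa385 cVConc cBConc
      fun_prop (disch := simp))
    (by simp)
  -- the constant `κ₁(α₁)` of (3.77) (FILE 16/20's explicit `κ₃₇₇(…)`) is continuous at `α₁ = 0`: a bound `K` below a threshold
  obtain ⟨K, ε₆, hK0, hε₆, hF6⟩ := exists_bound_of_continuousAt
    (f := fun α₁ : ℝ => (kappa377 (4 * (1 + ↑(Fintype.card κ)) * (M₂ * ∑ i, ‖b i‖) * Real.exp (1 / 4 * δ₀ * d₀)) (kappa349 κQ ((1 + ↑(Fintype.card κ)) * BG) B₁ Λ (B6.c1 d δ₀ (1 / 100))) (kappa368 κQ cF (kappa385 1 (cVConc (Fintype.card κ) 1 α₁ a₀ Cq M₂ (∑ i, ‖b i‖) (Real.exp (7 / 20 * δ₀ * d₀))) 0 0 Λ (B6.c1 d δ₀ (1 / 100))) (kappa366 κQ cF (kappa385 1 (cVConc (Fintype.card κ) 1 α₁ a₀ Cq M₂ (∑ i, ‖b i‖) (Real.exp (δ₀ * d₀))) 0 0 Λ (B6.c1 d δ₀ (1 / 100))) BG (BG * B6.c1 d (49 / 50 * δ₀) (1 / 100) * (1 - theta363 (Fintype.card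 κ) 1 α₁ a₀ Cq M₂ (∑ i, ‖b i‖) (Real.exp (δ₀ * d₀)) BG Λ (B6.c1 d δ₀ (1 / 100)) * B6.c1 d (49 / 50 * δ₀) (1 / 100))⁻¹) Λ (B6.c1 d δ₀ (1 / 100)) α₁) BG BG (BG * B6.c1 d (33 / 100 * δ₀) (1 / 100) * (1 - theta363 (Fintype.card κ) 1 α₁ a₀ Cq M₂ (∑ i, ‖b i‖) (Real.exp (7 / 20 * δ₀ * d₀)) BG Λ (B6.c1 d δ₀ (1 / 100)) * B6.c1 d (33 / 100 * δ₀) (1 / 100))⁻¹) B₁ (2 * B₁ * B6.c1 d ((1 / 2 - 1 / 10) * δ₀) (1 / 10)) Λ (B6.c1 d δ₀ (1 / 100)) α₁ + ↑(Fintype.card κ) * kappa368Ds κQ cF (kappa385 BG (cVConc (Fintype.card κ) 1 α₁ a₀ Cq M₂ (∑ i, ‖b i‖) (Real.exp (7 / 20 * δ₀ * d₀))) 0 0 Λ (B6.c1 d δ₀ (1 / 100))) (kappa366 κQ cF (kappa385 1 (cVConc (Fintype.card κ) 1 α₁ a₀ Cq M₂ (∑ i, ‖b i‖) (Real.exp (δ₀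 * d₀))) 0 0 Λ (B6.c1 d δ₀ (1 / 100))) BG (BG * B6.c1 d (49 / 50 * δ₀) (1 / 100) * (1 - theta363 (Fintype.card κ) 1 α₁ a₀ Cq M₂ (∑ i, ‖b i‖) (Real.exp (δ₀ * d₀)) BG Λ (B6.c1 d δ₀ (1 / 100)) * B6.c1 d (49 / 50 * δ₀) (1 / 100))⁻¹) Λ (B6.c1 d δ₀ (1 / 100)) α₁) BG BG BG (B6.c1 d (33 / 100 * δ₀) (1 / 100) * (1 - theta363 (Fintype.card κ) 1 α₁ a₀ Cq M₂ (∑ i, ‖b i‖) (Real.exp (7 / 20 * δ₀ * d₀)) BG Λ (B6.c1 d δ₀ (1 / 100)) * B6.c1 d (33 / 100 * δ₀) (1 / 100))⁻¹) (BG * Λρ₁ ^ 2 * B6.c1 d (33 / 100 * δ₀) (1 / 100) * (1 - thetaL363 (Fintype.card κ) 1 α₁ a₀ Cq M₂ (∑ i, ‖b i‖) (Real.exp (7 / 20 * δ₀ * d₀)) BG Λ (B6.c1 d δ₀ (1 / 100)) * B6.c1 d (33 / 100 * δ₀) (1 / 100))⁻¹) B₁ (2 * B₁ * B6.c1 d ((1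 / 2 - 1 / 10) * δ₀) (1 / 10)) (cBConc (Fintype.card κ) M₂ (∑ i, ‖b i‖) (Real.exp (B9Ineq368Vprime.rateC (1 / 100) (33 / 100 * δ₀) * d₀))) (cCConc (Fintype.card κ) 1 α₁ a₀ Cq M₂ (∑ i, ‖b i‖) (Real.exp (B9Ineq368Vprime.rateC (1 / 100) (33 / 100 * δ₀) * d₀))) Λ (B6.c1 d δ₀ (1 / 100)) α₁) Λ (B6.c1 d δ₀ (1 / 100)) α₁))
    (by
      unfold theta363 thetaL363 kappa368 kappa368Ds kappa377 kappa366 kappa349 kappa385 cCConc cVConc cBConc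
      fun_prop (disch := simp))
  -- the threshold `a₁` and the `α₁`-independent constant `K`
  refine ⟨min (min (min ε₁ ε₂) (min ε₃ ε₅)) (min ε₆ (1 / 2)) / 2,
    half_pos (lt_min (lt_min (lt_min hε₁ hε₂) (lt_min hε₃ hε₅)) (lt_min hε₆ one_half_pos)), K, hK0, ?_⟩
  -- NOW the lattice, the background, the letters and Theorems 3.1/3.2 for `U`; then `α₁`, `A`, the (3.57)/(3.59) letters
  intro S _ _ T U g _ _ _ Rr H blk kQ sQ cfun w hdnn htri hrefl hsym hlen hlenη hη h261 hST hU1 hd₀B hd₀F hd₀0 hw hcard hkQ hsQ hcfun Gp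
    h342_1 h342_2 h342_3 rep hrep Qc Qcs Linv hQc hQcs hLinv h348 α₁ hα₁0 hα₁1 A kF sF hkF hsF h337B h337F h337Bτ hA hAτB Qc' Fc Qcs' Fcs h357 h357s hFc hFcs
  obtain ⟨y₀⟩ := ‹Nonempty g.Site›
  obtain ⟨hT1, hT2, hT1i, hT2i, hT4, -⟩ := hST (1 / 100) (by norm_num)
  obtain ⟨hTρ₁0, -, -, -, -, -⟩ := hST (1 / 100 * (33 / 100)) (by norm_num)
  obtain ⟨-, -, -, -, -, hT4v⟩ := hST (1 / 10) (by norm_num)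
  rw [hΛeq] at hT1 hT2 hT1i hT2i hT4
  rw [hΛρ₁eq] at hTρ₁0
  rw [hc₄eq] at hT4v
  have hTρ₁ : ScaleTransfer g (33 / 100 * δ₀) (1 / 100) Λρ₁ (fun a => g.len a) := scaleTransfer_rescale hTρ₁0
  -- [4] Lemma 2.1 at the (rate, exponent) pairs of the cascade, all read from the one printed rate `δ₀`
  have h261β : Ineq261 d (toB6 g Rr H) δ₀ (1 / 100) := h261 _ (by norm_num) (by norm_num)
  have h261'' : Ineq261 d (toB6 g Rr H) (33 / 100 * δ₀) (1 / 100) :=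
    ineq261_rescale (h261 (1 / 100 * (33 / 100)) (by norm_num) (by norm_num))
  have h261c : Ineq261 d (toB6 g Rr H) (49 / 50 * δ₀) (1 / 100) :=
    ineq261_rescale (h261 (1 / 100 * (49 / 50)) (by norm_num) (by norm_num))
  have h261v : Ineq261 d (toB6 g Rr H) δ₀ (1 / 2 + 1 / 10) := h261 _ (by norm_num) (by norm_num)
  have h261v' : Ineq261 d (toB6 g Rr H) ((1 / 2 - 1 / 10) * δ₀) (1 / 10) :=
    ineq261_rescale (h261 (1 / 10 * (1 / 2 - 1 / 10)) (by norm_num) (by norm_num))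
  -- `c₁ > 0` at these pairs (non-empty 𝔅)
  have hc₂ : 0 < B6.c1 d δ₀ (1 / 100) := c1_pos_of_ineq261 h261β y₀ (hrefl y₀)
  have hc'' : 0 < B6.c1 d (33 / 100 * δ₀) (1 / 100) := c1_pos_of_ineq261 h261'' y₀ (hrefl y₀)
  have hcc' : 0 < B6.c1 d (49 / 50 * δ₀) (1 / 100) := c1_pos_of_ineq261 h261c y₀ (hrefl y₀)
  have hc₁v : 0 < B6.c1 d δ₀ (1 / 2 + 1 / 10) := c1_pos_of_ineq261 h261v y₀ (hrefl y₀)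
  have hc₁v' : 0 < B6.c1 d ((1 / 2 - 1 / 10) * δ₀) (1 / 10) := c1_pos_of_ineq261 h261v' y₀ (hrefl y₀)
  -- the linear side conditions of the cascade
  have hrP : 1 / 5 * δ₀ + 2 * ((1 / 100 + 1 / 100) * δ₀) ≤ 1 / 4 * δ₀ := by linarith only [hδ₀]
  have hrG : 1 / 4 * δ₀ + (2 * (1 / 100) + 1 / 100) * δ₀ ≤ 7 / 20 * δ₀ := by linarith only [hδ₀]
  have hr1 : 33 / 100 * δ₀ + (1 / 100 + 1 / 100) * δ₀ ≤ 7 / 20 * δ₀ := by linarith only [hδ₀]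
  have hr368 : 1 / 4 * δ₀ + 2 * ((2 * (1 / 100) + 1 / 100) * δ₀) ≤ B9Ineq368Vprime.rateC (1 / 100) (33 / 100 * δ₀) := by
    unfold B9Ineq368Vprime.rateC; linarith only [hδ₀]
  have hrc1 : 49 / 50 * δ₀ + (1 / 100 + 1 / 100) * δ₀ ≤ δ₀ := by linarith only [hδ₀]
  have hrc : δ₀ / 2 + (1 / 100 + 1 / 100) * δ₀ ≤ (1 - 1 / 100) * (49 / 50 * δ₀) := by linarith only [hδ₀]
  have hrcG : 7 / 20 * δ₀ + (1 / 100 + 1 / 100) * δ₀ ≤ (1 - 1 / 100) * (49 / 50 * δ₀) := by linarith only [hδ₀]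
  have hGδ1 : 7 / 20 * δ₀ ≤ δ₀ := by linarith only [hδ₀]
  have hrCinv : 7 / 20 * δ₀ ≤ (1 - 1 / 10) * ((1 / 2 - 1 / 10) * δ₀) := by linarith only [hδ₀]
  have hδ5 : 0 ≤ 1 / 5 * δ₀ := by linarith only [hδ₀]
  have hρ₁0 : 0 ≤ 33 / 100 * δ₀ := by linarith only [hδ₀]
  have hρc0 : 0 ≤ 49 / 50 * δ₀ := by linarith only [hδ₀]
  have hα''ρ : 0 ≤ (1 - 1 / 100) * (33 / 100 * δ₀) := by linarith only [hδ₀]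
  have hα''ρ2 : 0 ≤ (1 - 2 * (1 / 100)) * (33 / 100 * δ₀) := by linarith only [hδ₀]
  have hα''ρ3 : 0 ≤ (1 - 3 * (1 / 100)) * (33 / 100 * δ₀) := by linarith only [hδ₀]
  -- «for α₁ sufficiently small» (pp. 402, 403): the four threshold functions of the `C⁻¹(U′U)`/`P′(A)`-chain are CONTINUOUS AT `α₁ = 0` and vanish there
  have hmε₁ : min (min (min ε₁ ε₂) (min ε₃ ε₅)) (min ε₆ (1 / 2)) ≤ ε₁ := (min_le_left _ _).trans ((min_le_left _ _).trans (min_le_left _ _))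
  have hmε₂ : min (min (min ε₁ ε₂) (min ε₃ ε₅)) (min ε₆ (1 / 2)) ≤ ε₂ := (min_le_left _ _).trans ((min_le_left _ _).trans (min_le_right _ _))
  have hmε₃ : min (min (min ε₁ ε₂) (min ε₃ ε₅)) (min ε₆ (1 / 2)) ≤ ε₃ := (min_le_left _ _).trans ((min_le_right _ _).trans (min_le_left _ _))
  have hmε₅ : min (min (min ε₁ ε₂) (min ε₃ ε₅)) (min ε₆ (1 / 2)) ≤ ε₅ := (min_le_left _ _).trans ((min_le_right _ _).trans (min_le_right _ _))
  have hmε₆ : min (min (min ε₁ ε₂) (min ε₃ ε₅)) (min ε₆ (1 / 2)) ≤ ε₆ := (min_le_right _ _).trans (min_le_left _ _)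
  have hmh : min (min (min ε₁ ε₂) (min ε₃ ε₅)) (min ε₆ (1 / 2)) ≤ 1 / 2 := (min_le_right _ _).trans (min_le_right _ _)
  have habs : |α₁| = α₁ := abs_of_nonneg hα₁0
  have h1 : theta363 (Fintype.card κ) 1 α₁ a₀ Cq M₂ (∑ i, ‖b i‖) (Real.exp (δ₀ * d₀)) BG Λ (B6.c1 d δ₀ (1 / 100)) * B6.c1 d (49 / 50 * δ₀) (1 / 100) < 1 / 2 := hF1 α₁ (by rw [habs]; linarith only [hα₁1, hmε₁, hε₁])
  have h2 : theta363 (Fintype.card κ) 1 α₁ a₀ Cq M₂ (∑ i, ‖b i‖) (Real.exp (7 / 20 * δ₀ * d₀)) BG Λ (B6.c1 d δ₀ (1 / 100)) * B6.c1 d (33 / 100 * δ₀) (1 / 100) < 1 / 2 := hF2 α₁ (by rw [habs]; linarith only [hα₁1, hmε₂, hε₂])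
  have h3 : thetaL363 (Fintype.card κ) 1 α₁ a₀ Cq M₂ (∑ i, ‖b i‖) (Real.exp (7 / 20 * δ₀ * d₀)) BG Λ (B6.c1 d δ₀ (1 / 100)) * B6.c1 d (33 / 100 * δ₀) (1 / 100) < 1 / 2 := hF3 α₁ (by rw [habs]; linarith only [hα₁1, hmε₃, hε₃])
  have h5 : α₁ * (2 * (kappa366 κQ cF (kappa385 1 (cVConc (Fintype.card κ) 1 α₁ a₀ Cq M₂ (∑ i, ‖b i‖) (Real.exp (δ₀ * d₀))) 0 0 Λ (B6.c1 d δ₀ (1 / 100))) BG (BG * B6.c1 d (49 / 50 * δ₀) (1 / 100) * (1 - theta363 (Fintype.card κ) 1 α₁ a₀ Cq M₂ (∑ i, ‖b i‖) (Real.exp (δ₀ * d₀)) BG Λ (B6.c1 d δ₀ (1 / 100)) * B6.c1 d (49 / 50 * δ₀) (1 / 100))⁻¹) Λ (B6.c1 d δ₀ (1 / 100)) α₁ * B₁ * c₄ * B6.c1 d δ₀ (1 / 2 + 1 / 10)) * B6.c1 d ((1 / 2 - 1 / 10) * δ₀) (1 / 10)) < 1 / 2 :=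
    hF5 α₁ (by rw [habs]; linarith only [hα₁1, hmε₅, hε₅])
  have h6 := hF6 α₁ (by rw [habs]; linarith only [hα₁1, hmε₆, hε₆])
  have hhalf : (1 / 2 : ℝ) < 1 := by norm_num
  -- `η·α₁(Lʲη)⁻¹ ≦ 1/4` from `α₁ ≦ 1/4` and `η ≦ Lʲη`
  have hsmall : ∀ y : g.Site, g.eta * (α₁ * (g.len y)⁻¹) ≤ 1 / 4 := fun y => by
    have hq : g.eta * (g.len y)⁻¹ ≤ 1 := by
      rw [← div_eq_mul_inv]; exact (div_le_one (hlen y)).mpr (hlenη y)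
    calc g.eta * (α₁ * (g.len y)⁻¹) = α₁ * (g.eta * (g.len y)⁻¹) := by ring
      _ ≤ α₁ * 1 := mul_le_mul_of_nonneg_left hq hα₁0
      _ ≤ 1 / 4 := by linarith only [hα₁1, hmh]
  -- signs of the explicit constants at this `α₁`
  have hcV0E : ∀ E : ℝ, 0 ≤ E →
      0 ≤ kappa385 1 (cVConc (Fintype.card κ) 1 α₁ a₀ Cq M₂ (∑ i, ‖b i‖) E) 0 0 Λ (B6.c1 d δ₀ (1 / 100)) := fun E hE =>
    kappa385_nonneg zero_le_one (cVConc_nonneg hα₁0 ha₀ hCq hM₂ hSb hE) le_rfl le_rfl hΛ0.le hc₂.le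
  have hcV0G : 0 ≤ kappa385 BG (cVConc (Fintype.card κ) 1 α₁ a₀ Cq M₂ (∑ i, ‖b i‖) (Real.exp (7 / 20 * δ₀ * d₀))) 0 0 Λ (B6.c1 d δ₀ (1 / 100)) :=
    kappa385_nonneg hBG.le (cVConc_nonneg hα₁0 ha₀ hCq hM₂ hSb (Real.exp_nonneg _)) le_rfl le_rfl hΛ0.le hc₂.le
  have hNc : 0 < BG * B6.c1 d (49 / 50 * δ₀) (1 / 100) * (1 - theta363 (Fintype.card κ) 1 α₁ a₀ Cq M₂ (∑ i, ‖b i‖) (Real.exp (δ₀ * d₀)) BG Λ (B6.c1 d δ₀ (1 / 100)) * B6.c1 d (49 / 50 * δ₀) (1 / 100))⁻¹ :=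
    mul_pos (mul_pos hBG hcc') (inv_pos.mpr (by linarith only [h1]))
  have hN'' : 0 ≤ BG * B6.c1 d (33 / 100 * δ₀) (1 / 100) * (1 - theta363 (Fintype.card κ) 1 α₁ a₀ Cq M₂ (∑ i, ‖b i‖) (Real.exp (7 / 20 * δ₀ * d₀)) BG Λ (B6.c1 d δ₀ (1 / 100)) * B6.c1 d (33 / 100 * δ₀) (1 / 100))⁻¹ :=
    mul_nonneg (mul_nonneg hBG.le hc''.le) (inv_nonneg.mpr (by linarith only [h2]))
  have hN3 : 0 ≤ B6.c1 d (33 / 100 * δ₀) (1 / 100) * (1 - theta363 (Fintype.card κ) 1 α₁ a₀ Cq M₂ (∑ i, ‖b i‖) (Real.exp (7 / 20 * δ₀ * d₀)) BG Λ (B6.c1 d δ₀ (1 / 100)) * B6.c1 d (33 / 100 * δ₀) (1 / 100))⁻¹ :=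
    mul_nonneg hc''.le (inv_nonneg.mpr (by linarith only [h2]))
  have hN3L : 0 ≤ BG * Λρ₁ ^ 2 * B6.c1 d (33 / 100 * δ₀) (1 / 100) * (1 - thetaL363 (Fintype.card κ) 1 α₁ a₀ Cq M₂ (∑ i, ‖b i‖) (Real.exp (7 / 20 * δ₀ * d₀)) BG Λ (B6.c1 d δ₀ (1 / 100)) * B6.c1 d (33 / 100 * δ₀) (1 / 100))⁻¹ :=
    mul_nonneg (mul_nonneg (mul_nonneg hBG.le (sq_nonneg Λρ₁)) hc''.le) (inv_nonneg.mpr (by linarith only [h3]))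
  have hκC0 : 0 < kappa366 κQ cF (kappa385 1 (cVConc (Fintype.card κ) 1 α₁ a₀ Cq M₂ (∑ i, ‖b i‖) (Real.exp (δ₀ * d₀))) 0 0 Λ (B6.c1 d δ₀ (1 / 100))) BG (BG * B6.c1 d (49 / 50 * δ₀) (1 / 100) * (1 - theta363 (Fintype.card κ) 1 α₁ a₀ Cq M₂ (∑ i, ‖b i‖) (Real.exp (δ₀ * d₀)) BG Λ (B6.c1 d δ₀ (1 / 100)) * B6.c1 d (49 / 50 * δ₀) (1 / 100))⁻¹) Λ (B6.c1 d δ₀ (1 / 100)) α₁ :=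
    kappa366_pos hκQ hcF (hcV0E _ (Real.exp_nonneg _)) hNc hΛ0 hc₂ hα₁0
  have hBc0 : 0 ≤ 2 * B₁ * B6.c1 d ((1 / 2 - 1 / 10) * δ₀) (1 / 10) := mul_nonneg (mul_nonneg zero_le_two hB₁.le) hc₁v'.le
  have hK1nn : 0 ≤ kappa368 κQ cF (kappa385 1 (cVConc (Fintype.card κ) 1 α₁ a₀ Cq M₂ (∑ i, ‖b i‖) (Real.exp (7 / 20 * δ₀ * d₀))) 0 0 Λ (B6.c1 d δ₀ (1 / 100))) (kappa366 κQ cF (kappa385 1 (cVConc (Fintype.card κ) 1 α₁ a₀ Cq M₂ (∑ i, ‖b i‖) (Real.exp (δ₀ * d₀))) 0 0 Λ (B6.c1 d δ₀ (1 / 100))) BG (BG * B6.c1 d (49 / 50 * δ₀) (1 / 100) * (1 - theta363 (Fintype.card κ) 1 α₁ a₀ Cq M₂ (∑ i, ‖b i‖) (Real.exp (δ₀ * d₀)) BG Λ (B6.c1 d δ₀ (1 / 100)) * B6.c1 d (49 / 50 * δ₀) (1 / 100))⁻¹) Λ (B6.c1 d δ₀ (1 / 100)) α₁) BG BG (BG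 * B6.c1 d (33 / 100 * δ₀) (1 / 100) * (1 - theta363 (Fintype.card κ) 1 α₁ a₀ Cq M₂ (∑ i, ‖b i‖) (Real.exp (7 / 20 * δ₀ * d₀)) BG Λ (B6.c1 d δ₀ (1 / 100)) * B6.c1 d (33 / 100 * δ₀) (1 / 100))⁻¹) B₁ (2 * B₁ * B6.c1 d ((1 / 2 - 1 / 10) * δ₀) (1 / 10)) Λ (B6.c1 d δ₀ (1 / 100)) α₁ :=
    kappa368_nonneg hκQ.le hcF.le (hcV0E _ (Real.exp_nonneg _)) hκC0.le hBG.le hBG.le hN'' hB₁.le hBc0 hc₂.le hα₁0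
  have hcB : 0 ≤ cBConc (Fintype.card κ) M₂ (∑ i, ‖b i‖) (Real.exp (B9Ineq368Vprime.rateC (1 / 100) (33 / 100 * δ₀) * d₀)) := by
    unfold cBConc
    exact mul_nonneg (mul_nonneg zero_le_two (Nat.cast_nonneg _))
      (mul_nonneg (mul_nonneg (mul_nonneg zero_le_two hM₂) hSb) (Real.exp_nonneg _))
  have hcC : 0 ≤ cCConc (Fintype.card κ) 1 α₁ a₀ Cq M₂ (∑ i, ‖b i‖)
      (Real.exp (B9Ineq368Vprime.rateC (1 / 100) (33 / 100 * δ₀) * d₀)) := by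
    unfold cCConc
    have i0 : 0 ≤ 2 + Cq * α₁ := by have := mul_nonneg hCq hα₁0; linarith only [this]
    have i1 : 0 ≤ (2 + 8 * (1 : ℝ) ^ 2 * α₁) * (Fintype.card κ : ℝ) := mul_nonneg (by linarith only [hα₁0]) (Nat.cast_nonneg _)
    have i2 : 0 ≤ a₀ * Cq * (2 + Cq * α₁) := mul_nonneg (mul_nonneg ha₀ hCq) i0
    have i3 : 0 ≤ 4 * (Fintype.card κ : ℝ) * (1 : ℝ) ^ 2 := by positivity
    exact mul_nonneg (mul_nonneg (mul_nonneg (add_nonneg (add_nonneg i1 i2) i3) hM₂) hSb) (Real.exp_nonneg _)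
  have hK3nn : 0 ≤ ↑(Fintype.card κ) * kappa368Ds κQ cF (kappa385 BG (cVConc (Fintype.card κ) 1 α₁ a₀ Cq M₂ (∑ i, ‖b i‖) (Real.exp (7 / 20 * δ₀ * d₀))) 0 0 Λ (B6.c1 d δ₀ (1 / 100))) (kappa366 κQ cF (kappa385 1 (cVConc (Fintype.card κ) 1 α₁ a₀ Cq M₂ (∑ i, ‖b i‖) (Real.exp (δ₀ * d₀))) 0 0 Λ (B6.c1 d δ₀ (1 / 100))) BG (BG * B6.c1 d (49 / 50 * δ₀) (1 / 100) * (1 - theta363 (Fintype.card κ) 1 α₁ a₀ Cq M₂ (∑ i, ‖b i‖) (Real.exp (δ₀ * d₀)) BG Λ (B6.c1 d δ₀ (1 / 100)) * B6.c1 d (49 / 50 * δ₀) (1 / 100))⁻¹) Λ (B6.c1 d δ₀ (1 / 100)) α₁) BG BG BG (B6.c1 d (33 / 100 * δ₀) (1 / 100) * (1 - theta363 (Fintype.card κ) 1 α₁ a₀ Cq M₂ (∑ i, ‖b i‖) (Real.exp (7 / 20 * δ₀ * d₀)) BG Λ (B6.c1 d δ₀ (1 / 100)) * B6.c1 d (33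 / 100 * δ₀) (1 / 100))⁻¹) (BG * Λρ₁ ^ 2 * B6.c1 d (33 / 100 * δ₀) (1 / 100) * (1 - thetaL363 (Fintype.card κ) 1 α₁ a₀ Cq M₂ (∑ i, ‖b i‖) (Real.exp (7 / 20 * δ₀ * d₀)) BG Λ (B6.c1 d δ₀ (1 / 100)) * B6.c1 d (33 / 100 * δ₀) (1 / 100))⁻¹) B₁ (2 * B₁ * B6.c1 d ((1 / 2 - 1 / 10) * δ₀) (1 / 10)) (cBConc (Fintype.card κ) M₂ (∑ i, ‖b i‖) (Real.exp (B9Ineq368Vprime.rateC (1 / 100) (33 / 100 * δ₀) * d₀))) (cCConc (Fintype.card κ) 1 α₁ a₀ Cq M₂ (∑ i, ‖b i‖) (Real.exp (B9Ineq368Vprime.rateC (1 / 100) (33 / 100 * δ₀) * d₀))) Λ (B6.c1 d δ₀ (1 / 100)) α₁ :=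
    mul_nonneg (Nat.cast_nonneg _) (kappa368Ds_nonneg hκQ.le hcF.le hcV0G hκC0.le hBG.le hBG.le hBG.le hN3 hN3L hB₁.le hBc0
      hcB hcC hc₂.le hα₁0)
  have hXpos : 0 < 2 * (kappa366 κQ cF (kappa385 1 (cVConc (Fintype.card κ) 1 α₁ a₀ Cq M₂ (∑ i, ‖b i‖) (Real.exp (δ₀ * d₀))) 0 0 Λ (B6.c1 d δ₀ (1 / 100))) BG (BG * B6.c1 d (49 / 50 * δ₀) (1 / 100) * (1 - theta363 (Fintype.card κ) 1 α₁ a₀ Cq M₂ (∑ i, ‖b i‖) (Real.exp (δ₀ * d₀)) BG Λ (B6.c1 d δ₀ (1 / 100)) * B6.c1 d (49 / 50 * δ₀) (1 / 100))⁻¹) Λ (B6.c1 d δ₀ (1 / 100)) α₁ * B₁ * c₄ * B6.c1 d δ₀ (1 / 2 + 1 / 10)) * B6.c1 d ((1 / 2 - 1 / 10) * δ₀) (1 / 10) :=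
    mul_pos (mul_pos two_pos (mul_pos (mul_pos (mul_pos hκC0 hB₁) hc₄) hc₁v)) hc₁v'
  have ha₁' : α₁ ≤ (2 * (kappa366 κQ cF (kappa385 1 (cVConc (Fintype.card κ) 1 α₁ a₀ Cq M₂ (∑ i, ‖b i‖) (Real.exp (δ₀ * d₀))) 0 0 Λ (B6.c1 d δ₀ (1 / 100))) BG (BG * B6.c1 d (49 / 50 * δ₀) (1 / 100) * (1 - theta363 (Fintype.card κ) 1 α₁ a₀ Cq M₂ (∑ i, ‖b i‖) (Real.exp (δ₀ * d₀)) BG Λ (B6.c1 d δ₀ (1 / 100)) * B6.c1 d (49 / 50 * δ₀) (1 / 100))⁻¹) Λ (B6.c1 d δ₀ (1 / 100)) α₁ * B₁ * c₄ * B6.c1 d δ₀ (1 / 2 + 1 / 10)) * B6.c1 d ((1 / 2 - 1 / 10) * δ₀) (1 / 10))⁻¹ := by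
    rw [inv_eq_one_div, le_div_iff₀ hXpos]; linarith only [h5]
  -- §2 with the cascade, the explicit constants and the thresholds
  obtain ⟨Tinv, hTl, hTr, hP₁⟩ := exists_cinv_pOne_concrete (Rr := Rr) (H := H) b T U blk d
    δ₀ (1 / 5 * δ₀) (1 / 4 * δ₀) (7 / 20 * δ₀) δ₀ (49 / 50 * δ₀) (1 / 100) (1 / 10) (1 / 10) c₄ (1 / 100) (1 / 100)
    (33 / 100 * δ₀) (1 / 100) Λ Λρ₁ κQ BG B₁ _ _ cF Cq a₀ _
    (kappa368 κQ cF (kappa385 1 (cVConc (Fintype.card κ) 1 α₁ a₀ Cq M₂ (∑ i, ‖b i‖) (Real.exp (7 / 20 * δ₀ * d₀))) 0 0 Λ (B6.c1 d δ₀ (1 / 100))) (kappa366 κQ cF (kappa385 1 (cVConc (Fintype.card κ) 1 α₁ a₀ Cq M₂ (∑ i, ‖b i‖) (Real.exp (δ₀ * d₀))) 0 0 Λ (B6.c1 d δ₀ (1 / 100))) BG (BG * B6.c1 d (49 / 50 * δ₀) (1 / 100) * (1 - theta363 (Fintype.card κ) 1 α₁ a₀ Cq M₂ (∑ i, ‖b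 i‖) (Real.exp (δ₀ * d₀)) BG Λ (B6.c1 d δ₀ (1 / 100)) * B6.c1 d (49 / 50 * δ₀) (1 / 100))⁻¹) Λ (B6.c1 d δ₀ (1 / 100)) α₁) BG BG (BG * B6.c1 d (33 / 100 * δ₀) (1 / 100) * (1 - theta363 (Fintype.card κ) 1 α₁ a₀ Cq M₂ (∑ i, ‖b i‖) (Real.exp (7 / 20 * δ₀ * d₀)) BG Λ (B6.c1 d δ₀ (1 / 100)) * B6.c1 d (33 / 100 * δ₀) (1 / 100))⁻¹) B₁ (2 * B₁ * B6.c1 d ((1 / 2 - 1 / 10) * δ₀) (1 / 10)) Λ (B6.c1 d δ₀ (1 / 100)) α₁ + ↑(Fintype.card κ) * kappa368Ds κQ cF (kappa385 BG (cVConc (Fintype.card κ) 1 α₁ a₀ Cq M₂ (∑ i, ‖b i‖) (Real.exp (7 / 20 * δ₀ * d₀))) 0 0 Λ (B6.c1 d δ₀ (1 / 100))) (kappa366 κQ cF (kappa385 1 (cVConc (Fintype.card κ) 1 α₁ a₀ Cq M₂ (∑ i, ‖b i‖) (Real.exp (δ₀ * d₀))) 0 0 Λ (B6.c1 d δ₀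 (1 / 100))) BG (BG * B6.c1 d (49 / 50 * δ₀) (1 / 100) * (1 - theta363 (Fintype.card κ) 1 α₁ a₀ Cq M₂ (∑ i, ‖b i‖) (Real.exp (δ₀ * d₀)) BG Λ (B6.c1 d δ₀ (1 / 100)) * B6.c1 d (49 / 50 * δ₀) (1 / 100))⁻¹) Λ (B6.c1 d δ₀ (1 / 100)) α₁) BG BG BG (B6.c1 d (33 / 100 * δ₀) (1 / 100) * (1 - theta363 (Fintype.card κ) 1 α₁ a₀ Cq M₂ (∑ i, ‖b i‖) (Real.exp (7 / 20 * δ₀ * d₀)) BG Λ (B6.c1 d δ₀ (1 / 100)) * B6.c1 d (33 / 100 * δ₀) (1 / 100))⁻¹) (BG * Λρ₁ ^ 2 * B6.c1 d (33 / 100 * δ₀) (1 / 100) * (1 - thetaL363 (Fintype.card κ) 1 α₁ a₀ Cq M₂ (∑ i, ‖b i‖) (Real.exp (7 / 20 * δ₀ * d₀)) BG Λ (B6.c1 d δ₀ (1 / 100)) * B6.c1 d (33 / 100 * δ₀) (1 / 100))⁻¹) B₁ (2 * B₁ * B6.c1 d ((1 / 2 - 1 / 10) * δ₀) (1 / 10))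 (cBConc (Fintype.card κ) M₂ (∑ i, ‖b i‖) (Real.exp (B9Ineq368Vprime.rateC (1 / 100) (33 / 100 * δ₀) * d₀))) (cCConc (Fintype.card κ) 1 α₁ a₀ Cq M₂ (∑ i, ‖b i‖) (Real.exp (B9Ineq368Vprime.rateC (1 / 100) (33 / 100 * δ₀) * d₀))) Λ (B6.c1 d δ₀ (1 / 100)) α₁)
    _ α₁ d₀ M₂ kQ kF sQ sF cfun w
    hκQ hBG hB₁ hcF hCq ha₀ (add_nonneg hK1nn hK3nn) hα₁0 hΛ (by norm_num) (by norm_num) hδ₀ hδ5 hM₂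
    hrP hrG hr1 (by norm_num) (by norm_num) hρ₁0 hα''ρ hα''ρ2 hα''ρ3 hΛρ₁ hr368
    hrc1 hρc0 (by norm_num) (by norm_num) hrc hrcG hGδ1 hGδ1 (by norm_num) (by norm_num) (by norm_num) hc₄ hrCinv hc₁v hc₁v' hc₂ hcc'
    rfl rfl ha₁' rfl rfl hdnn htri hrefl hsym hlen h261β h261'' h261c h261v h261v' hT1 hT2 hT1i hT2i hT4 hTρ₁ hT4v hrepr hη A hsmall hU1
    h337B h337F h337Bτ hA hAτB hd₀B hd₀F hd₀0 h342_1 h342_2 h342_3 rep hrep h357 h357s hQc hQcs hFc hFcs hLinv h348 (h1.trans hhalf)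
    hw hcard hkQ hkF hsQ hsF hcfun (h2.trans hhalf) (h3.trans hhalf) (le_add_of_nonneg_right hK3nn) (le_add_of_nonneg_left hK1nn)
  refine ⟨Tinv, hTl, hTr, hasMajorant_mono (g := toB6 g Rr H) _ hP₁ fun a a' => ?_⟩
  exact mul_le_mul_of_nonneg_right (mul_le_mul_of_nonneg_right (mul_le_mul_of_nonneg_right h6 hα₁0) (inv_nonneg.mpr (sq_nonneg _)))
    (Real.exp_nonneg _)

end POneU

end Literature.MathematicalPhysics.QuantumFieldTheory.Balaban1983to89.B9Thm34POneUniformR1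

end
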